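import Summits.CriticalPhenomena.SAWScalingLimit.Theses.SAWRestrictionRigidity
import Literature.Probability.RandomPlanarGeometry.LatticeSimilarityCovariance
import Literature.Probability.RandomPlanarGeometry.ConformalRestrictionProofs
import HarnessLib

/-!
# The quarter-turn descends and pins the modulus (stub 3a `stub_quarterTurnDescent` of line
# `registered` for crux `Rigidity`, stmt-CriticalPhenomena-1368, route SAWRestrictionRigidity)

Setting: a chordal curve family `P` on Dobrushin domains, a real continuous linear automorphism
`L : ℂ ≃L[ℝ] ℂ` of the plane and the transported family `S D = (L⁻¹)_* P (L D)`.  If `P` is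
covariant under the lattice similarity group `z ↦ r iᵏ z + w` (`r > 0`, `k ∈ ℕ`, `w ∈ ℂ`) and
every real-linear symmetry `M` of `S` is complex-linear (`M = c •`) or complex-antilinear
(`M = c conj •`), then `L` itself is complex-linear or complex-antilinear.

Proof (pure transport algebra).  The quarter-turn `k = 1` of `P` descends to the real-linear
symmetry `M = L⁻¹ ∘ (i •) ∘ L` of `S` (`MarkedDomain.map_map`, `Measure.map_map`,
`CurveClass.map_homeomorph_trans`).  Since `M ∘ M = -id`, the antilinear alternative
`M z = c z̄` gives `M (M z) = |c|² z ≠ -z`, absurd; so `M = c •` with `c² = -1`, `c = ± i`, i.e.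
`L (i z) = ± i L z`, whence `L z = L 1 · z` (real-linearity + commuting with `i`) or
`L z = L 1 · z̄` (anticommuting with `i`).

Main result: `stub_quarterTurnDescent` (registered signature, verbatim).  Helpers:
`apply_eq_re_add_im` (real-linear splitting along `1, i`), `eq_mul_of_map_I_mul`,
`eq_mul_conj_of_map_I_mul`.  The quarter-turn `z ↦ i z` as `ℂ ≃L[ℝ] ℂ` is Mathlib's
`ContinuousLinearEquiv.unitsEquivAut ℂ (Units.mk0 I _)` with scalars restricted to `ℝ`.
-/

noncomputable section

namespace Summit.CriticalPhenomena.SAWScalingLimit.Cruxes.Rigidity.Birth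

open MeasureTheory Literature.Probability.RandomPlanarGeometry
open scoped ComplexConjugate

/-- A real-linear automorphism of `ℂ` splits along `z = re z + im z · i`. -/
theorem apply_eq_re_add_im (L : ℂ ≃L[ℝ] ℂ) (z : ℂ) :
    L z = (z.re : ℂ) * L 1 + (z.im : ℂ) * L Complex.I := by
  have h : z = (z.re : ℝ) • (1 : ℂ) + (z.im : ℝ) • Complex.I := by
    rw [Complex.real_smul, Complex.real_smul, mul_one, Complex.re_add_im]
  conv_lhs => rw [h]
  rw [map_add, L.map_smul, L.map_smul, Complex.real_smul, Complex.real_smul]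

/-- A real-linear automorphism of `ℂ` commuting with multiplication by `i` is complex-linear:
it is multiplication by its value at `1`. -/
theorem eq_mul_of_map_I_mul (L : ℂ ≃L[ℝ] ℂ)
    (h : ∀ z : ℂ, L (Complex.I * z) = Complex.I * L z) (z : ℂ) : L z = L 1 * z := by
  have hI : L Complex.I = Complex.I * L 1 := by rw [← h 1, mul_one]
  rw [apply_eq_re_add_im, hI]
  conv_rhs => rw [← Complex.re_add_im z]
  ring

/-- A real-linear automorphism of `ℂ` anticommuting with multiplication by `i` is
complex-antilinear: it is multiplication of the conjugate by its value at `1`. -/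
theorem eq_mul_conj_of_map_I_mul (L : ℂ ≃L[ℝ] ℂ)
    (h : ∀ z : ℂ, L (Complex.I * z) = -(Complex.I * L z)) (z : ℂ) : L z = L 1 * conj z := by
  have hI : L Complex.I = -(Complex.I * L 1) := by rw [← h 1, mul_one]
  have hc : conj z = (z.re : ℂ) - (z.im : ℂ) * Complex.I := Complex.ext (by simp) (by simp)
  rw [apply_eq_re_add_im, hI, hc]
  ring

/-- stub 3a ("the quarter-turn descends and pins the modulus"; reshaped by the lead from the
birth stub `stub_modulusPinned`): if `S D = (L⁻¹)_* P (L D)` for a real-linear automorphism `L`,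
`P` is covariant under the lattice similarity group `z ↦ r·iᵏ·z + w` (verbatim crux clause) and
every real-linear symmetry of `S` is complex-linear or complex-antilinear, then `L` itself is
complex-linear or complex-antilinear. Content: the quarter-turn of `P` (`k = 1`) descends to the
linear symmetry `M = L⁻¹ ∘ (I •) ∘ L` of `S` (`MarkedDomain.map_map`, `Measure.map_map`,
`CurveClass.map_homeomorph_trans`); `M ∘ M = -id`, so the antilinear alternative `M z = c z̄`
(`M² = |c|²`) is absurd and `M = c •` with `c² = -1`, i.e. `L (i z) = ± i L z`. -/
theorem stub_quarterTurnDescent : ∀ (P S : Literature.Probability.RandomPlanarGeometry.ChordalFamily) (L : ℂ ≃L[ℝ] ℂ), (∀ D : Literature.Probability.RandomPlanarGeometry.DobrushinDomain, S D = (P (D.map L.toHomeomorph)).map (Literature.Probability.RandomPlanarGeometry.CurveClass.map (L.symm.toHomeomorph : C(ℂ, ℂ)))) → (∀ (D : Literature.Probability.RandomPlanarGeometry.DobrushinDomain) (c : ℂ) (hc : c ≠ 0) (w : ℂ), (∃ (r : ℝ) (k : ℕ), 0 < r ∧ c = (r : ℂ) * Complex.I ^ k) → P (D.map (Literature.Probability.RandomPlanarGeometry.similarity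 c hc w)) = (P D).map (Literature.Probability.RandomPlanarGeometry.CurveClass.map (Literature.Probability.RandomPlanarGeometry.similarity c hc w : C(ℂ, ℂ)))) → (∀ M : ℂ ≃L[ℝ] ℂ, (∀ D : Literature.Probability.RandomPlanarGeometry.DobrushinDomain, S (D.map M.toHomeomorph) = (S D).map (Literature.Probability.RandomPlanarGeometry.CurveClass.map (M.toHomeomorph : C(ℂ, ℂ)))) → (∃ c : ℂ, ∀ z : ℂ, M z = c * z) ∨ (∃ c : ℂ, ∀ z : ℂ, M z = c * (starRingEnd ℂ) z)) → (∃ c : ℂ, ∀ z : ℂ, L z = c * z) ∨ (∃ c : ℂ, ∀ z : ℂ, L z = c * (starRingEnd ℂ) z) := by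
  intro P S L hS hsim hnolin
  -- the conjugate `M = L⁻¹ ∘ (i •) ∘ L` of the quarter-turn `z ↦ z i = i z`, a real-linear
  -- automorphism of the plane
  obtain ⟨M, hMz⟩ : ∃ M : ℂ ≃L[ℝ] ℂ, ∀ z : ℂ, M z = L.symm (Complex.I * L z) :=
    ⟨(L.trans ((ContinuousLinearEquiv.unitsEquivAut ℂ
        (Units.mk0 Complex.I Complex.I_ne_zero)).restrictScalars ℝ)).trans L.symm, fun z => by
      show L.symm (L z * Complex.I) = L.symm (Complex.I * L z)
      rw [mul_comm]⟩
  have hLM : ∀ z : ℂ, L (M z) = Complex.I * L z := fun z => by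
    rw [hMz, L.apply_symm_apply]
  have hMM : ∀ z : ℂ, M (M z) = -z := fun z => by
    rw [hMz (M z), hLM, ← mul_assoc, Complex.I_mul_I, neg_one_mul, map_neg, L.symm_apply_apply]
  -- the quarter-turn (`r = 1`, `k = 1`) is a covariance of `P`
  have hsimI : ∀ D : DobrushinDomain,
      P (D.map (similarity Complex.I Complex.I_ne_zero 0)) =
        (P D).map (CurveClass.map (similarity Complex.I Complex.I_ne_zero 0 : C(ℂ, ℂ))) :=
    fun D => hsim D Complex.I Complex.I_ne_zero 0 ⟨1, 1, one_pos, by simp⟩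
  -- conjugation identities of plane homeomorphisms
  have h1 : M.toHomeomorph.trans L.toHomeomorph =
      L.toHomeomorph.trans (similarity Complex.I Complex.I_ne_zero 0) := by
    ext1 z
    show L (M z) = Complex.I * L z + 0
    rw [hLM, add_zero]
  have h2 : (similarity Complex.I Complex.I_ne_zero 0).trans L.symm.toHomeomorph =
      L.symm.toHomeomorph.trans M.toHomeomorph := by
    ext1 w
    show L.symm (Complex.I * w + 0) = M (L.symm w)
    rw [add_zero, hMz, L.apply_symm_apply]
  -- `M` is a symmetry of `S`
  have hM : ∀ D : DobrushinDomain,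
      S (D.map M.toHomeomorph) = (S D).map (CurveClass.map (M.toHomeomorph : C(ℂ, ℂ))) := by
    intro D
    rw [hS (D.map M.toHomeomorph), MarkedDomain.map_map, h1, ← MarkedDomain.map_map, hsimI,
      Measure.map_map (CurveClass.measurable_map _) (CurveClass.measurable_map _),
      ← CurveClass.map_homeomorph_trans, h2, CurveClass.map_homeomorph_trans,
      ← Measure.map_map (CurveClass.measurable_map _) (CurveClass.measurable_map _), ← hS D]
  rcases hnolin M hM with ⟨c, hc⟩ | ⟨c, hc⟩
  · -- complex-linear symmetry: `c² = -1`, so `c = ± i`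
    have hcc : c * c = -1 := by
      have h := hMM 1
      rw [hc (M 1), hc 1, mul_one] at h
      exact h
    have hLc : ∀ z : ℂ, L (c * z) = Complex.I * L z := fun z => by
      rw [← hc z]
      exact hLM z
    have hcI : c = Complex.I ∨ c = -Complex.I := by
      have h0 : (c - Complex.I) * (c + Complex.I) = 0 := by
        have : (c - Complex.I) * (c + Complex.I) = c * c - Complex.I * Complex.I := by ring
        rw [this, hcc, Complex.I_mul_I, sub_self]
      rcases mul_eq_zero.1 h0 with h | h
      · exact Or.inl (sub_eq_zero.1 h)
      · exact Or.inr (eq_neg_of_add_eq_zero_left h)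
    rcases hcI with rfl | rfl
    · exact Or.inl ⟨L 1, fun z => eq_mul_of_map_I_mul L hLc z⟩
    · refine Or.inr ⟨L 1, fun z => eq_mul_conj_of_map_I_mul L (fun z => ?_) z⟩
      calc L (Complex.I * z) = L (-Complex.I * -z) := by rw [neg_mul_neg]
        _ = Complex.I * L (-z) := hLc (-z)
        _ = -(Complex.I * L z) := by rw [map_neg, mul_neg]
  · -- complex-antilinear symmetry: `M (M 1) = |c|² ≠ -1`
    exfalso
    have h := hMM 1
    rw [hc (M 1), hc 1, map_one, mul_one, Complex.mul_conj] at h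
    have h' : Complex.normSq c = -1 := by
      have := congrArg Complex.re h
      simpa using this
    linarith [Complex.normSq_nonneg c]

end Summit.CriticalPhenomena.SAWScalingLimit.Cruxes.Rigidity.Birth
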